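import Literature.Topology.FourManifolds.GroupTrisections
import Literature.Topology.FourManifolds.StandardTrisectionSlotSymmetry
import Summits.SmoothPoincare4.SmoothPoincare4.Theorems.WaldhausenPairs.Negative.StandardPairSymmetries
import HarnessLib

/-!
# Stub `stub_goeritzS2` of line `power-twist-absorption` for crux `CongruenceShadows.ShadowsStandard`
(item stmt-SmoothPoincare4-14593, route route-SmoothPoincare4-CongruenceShadows)

**The Goeritz element `S₂` of the standard genus-3 Heegaard pair.**  Let
`S₃ = ⟨a₁,b₁,a₂,b₂,a₃,b₃ ∣ r = [a₁,b₁][a₂,b₂][a₃,b₃]⟩` be the genus-3 surface group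
(`SurfaceGroup 3`; `aᵢ₊₁ = SurfaceGroup.a i`, `bᵢ₊₁ = SurfaceGroup.b i`) and
`N₀ = ⟪a₁,a₂,b₃⟫`, `N₁ = ⟪a₁,b₂,a₃⟫` (`s4Kernels 0`, `s4Kernels 1`) the standard genus-3 Heegaard
pair of `S¹ × S²`-type kernels of the genus-3 trisection of `S⁴`.  The assignment
`S₂ : a₁ ↦ (b₃b₂)⁻¹a₁(b₃b₂), b₁ ↦ (b₃b₂)⁻¹b₁(b₃b₂), a₂ ↦ (b₃b₂)⁻¹a₂b₂, b₂ ↦ b₂,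
a₃ ↦ b₃⁻¹b₂⁻¹a₃b₃, b₃ ↦ b₃`
extends to an automorphism of `S₃` which stabilises `N₀` and `N₁` (on the face
`F₃ = S₃ ⧸ N₀ = F⟨x = b₁, y = b₂, z = a₃⟩` it acts by `x ↦ y⁻¹xy, y ↦ y, z ↦ y⁻¹z`).

Proof.  In the free group `F⟨a₁,…,b₃⟩` the assignment sends `r ↦ u r u⁻¹` with `u = b₂⁻¹b₃⁻¹`,
and the assignment `S₂⁻¹ : a₁ ↦ (b₃b₂)a₁(b₃b₂)⁻¹, b₁ ↦ (b₃b₂)b₁(b₃b₂)⁻¹, a₂ ↦ (b₃b₂)a₂b₂⁻¹, b₂ ↦ b₂,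
a₃ ↦ b₂b₃a₃b₃⁻¹, b₃ ↦ b₃` sends `r ↦ v r v⁻¹` with `v = b₃b₂`; both composites are the identity on
the generators already in the free group.  These four finite identities are checked by `decide`
(free reduction of explicit words), so both assignments descend to endomorphisms of `S₃` that are
mutually inverse (`exists_mulEquiv_of_gens`, a def-free repackaging of the template
`RelatorAut.ofGens` / `swapEquiv` allowing the relator to move by a conjugation).  Stability of
`N₀`, `N₁`: each of `S₂^{±1}(a₁), S₂^{±1}(a₂), S₂^{±1}(b₃)` is a product of conjugates of
`a₁^{±1}, a₂^{±1}, b₃^{±1}` (e.g. `(b₃b₂)⁻¹a₂b₂ = (b₃b₂)⁻¹a₂(b₃b₂) · b₂⁻¹b₃⁻¹b₂`), and likewise for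
`a₁, b₂, a₃`; conclude by `RelatorAut.map_normalClosure_eq_of`.

This is the registered stub `stub_goeritzS2` (STUB 3c) of the checked skeleton of the line.
Pure group theory over the tree's `SurfaceGroup`; no definitions, no named facts.
-/

-- the prescribed namespace `Summit.<P>.<Sub>.…` duplicates `SmoothPoincare4` (P = Sub)
set_option linter.dupNamespace false

open Literature.Topology.FourManifolds Subgroup

namespace Summit.SmoothPoincare4.SmoothPoincare4.Theorems.ShadowsStandard.PowerTwistAbsorption

/-- **Automorphisms of `S₃` from generator images** (def-free form of `RelatorAut.ofGens`, relator
allowed to move by a conjugation): if `f, f' : {a₁,…,b₃} → F₆` send the surface relator `r` to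
conjugates `u r u⁻¹`, `v r v⁻¹` and are mutually inverse on the generators in the free group, then
there is an automorphism `χ` of `S₃` acting on words by `f`, with inverse acting by `f'`.
[folklore] -/
private theorem exists_mulEquiv_of_gens (f f' : surfaceGen 3 → FreeGroup (surfaceGen 3))
    (u v : FreeGroup (surfaceGen 3))
    (h1 : FreeGroup.lift f (surfaceRelator 3) = u * surfaceRelator 3 * u⁻¹)
    (h2 : FreeGroup.lift f' (surfaceRelator 3) = v * surfaceRelator 3 * v⁻¹)
    (h3 : ∀ x, FreeGroup.lift f' (f x) = FreeGroup.of x)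
    (h4 : ∀ x, FreeGroup.lift f (f' x) = FreeGroup.of x) :
    ∃ χ : SurfaceGroup 3 ≃* SurfaceGroup 3,
      (∀ w, χ (PresentedGroup.mk _ w) = PresentedGroup.mk _ (FreeGroup.lift f w)) ∧
      (∀ w, χ.symm (PresentedGroup.mk _ w) = PresentedGroup.mk _ (FreeGroup.lift f' w)) := by
  -- an assignment moving `r` by a conjugation kills `r` in `S₃`
  have kill : ∀ (e : surfaceGen 3 → FreeGroup (surfaceGen 3)) (c : FreeGroup (surfaceGen 3)),
      FreeGroup.lift e (surfaceRelator 3) = c * surfaceRelator 3 * c⁻¹ →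
      ∀ r ∈ ({surfaceRelator 3} : Set (FreeGroup (surfaceGen 3))),
        ((PresentedGroup.mk ({surfaceRelator 3} : Set (FreeGroup (surfaceGen 3)))).comp
          (FreeGroup.lift e)) r = 1 := by
    intro e c he r hr
    rw [Set.mem_singleton_iff] at hr
    subst hr
    rw [MonoidHom.comp_apply, he, map_mul, map_mul, map_inv,
      PresentedGroup.one_of_mem (Set.mem_singleton _), mul_one, mul_inv_cancel]
  refine ⟨MonoidHom.toMulEquiv (presentedLift _ (kill f u h1)) (presentedLift _ (kill f' v h2))
      (PresentedGroup.ext fun x => ?_) (PresentedGroup.ext fun x => ?_), fun w => ?_, fun w => ?_⟩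
  · simp [PresentedGroup.of, FreeGroup.lift_apply_of, h3]
  · simp [PresentedGroup.of, FreeGroup.lift_apply_of, h4]
  · simp
  · simp

/-- **STUB 3c · `stub_goeritzS2`** (Goeritz generator, def-free, genus 3): the automorphism
`S₂ : a₁ ↦ (b₃b₂)⁻¹a₁(b₃b₂), b₁ ↦ (b₃b₂)⁻¹b₁(b₃b₂), a₂ ↦ (b₃b₂)⁻¹a₂b₂, b₂ ↦ b₂, a₃ ↦ b₃⁻¹b₂⁻¹a₃b₃,
b₃ ↦ b₃` of `S₃` (relator `r ↦ (b₂⁻¹b₃⁻¹) r (b₂⁻¹b₃⁻¹)⁻¹`; inverse `a₁ ↦ (b₃b₂)a₁(b₃b₂)⁻¹,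
b₁ ↦ (b₃b₂)b₁(b₃b₂)⁻¹, a₂ ↦ (b₃b₂)a₂b₂⁻¹, a₃ ↦ b₂b₃a₃b₃⁻¹`, `b₂, b₃` fixed, sending
`r ↦ (b₃b₂) r (b₃b₂)⁻¹`) stabilises `N₀ = ⟪a₁,a₂,b₃⟫` and `N₁ = ⟪a₁,b₂,a₃⟫`; on the face
`S₃ ⧸ N₀ = F⟨x = b₁, y = b₂, z = a₃⟩` it is `x ↦ y⁻¹xy, y ↦ y, z ↦ y⁻¹z`. [folklore] -/
theorem stub_goeritzS2 :
    ∃ χ : SurfaceGroup 3 ≃* SurfaceGroup 3,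
      χ (SurfaceGroup.a 0) = (SurfaceGroup.b 2 * SurfaceGroup.b 1)⁻¹ * SurfaceGroup.a 0 *
        (SurfaceGroup.b 2 * SurfaceGroup.b 1) ∧
      χ (SurfaceGroup.b 0) = (SurfaceGroup.b 2 * SurfaceGroup.b 1)⁻¹ * SurfaceGroup.b 0 *
        (SurfaceGroup.b 2 * SurfaceGroup.b 1) ∧
      χ (SurfaceGroup.a 1) = (SurfaceGroup.b 2 * SurfaceGroup.b 1)⁻¹ * SurfaceGroup.a 1 * SurfaceGroup.b 1 ∧
      χ (SurfaceGroup.b 1) = SurfaceGroup.b 1 ∧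
      χ (SurfaceGroup.a 2) = (SurfaceGroup.b 2)⁻¹ * (SurfaceGroup.b 1)⁻¹ * SurfaceGroup.a 2 * SurfaceGroup.b 2 ∧
      χ (SurfaceGroup.b 2) = SurfaceGroup.b 2 ∧
      (s4Kernels 0).map χ.toMonoidHom = s4Kernels 0 ∧ (s4Kernels 1).map χ.toMonoidHom = s4Kernels 1 := by
  -- the automorphism, from the generator images of `S₂` and `S₂⁻¹` (free-group identities by `decide`)
  obtain ⟨χ, hχ, hχ'⟩ := exists_mulEquiv_of_gens
    (fun x => if x.1 = 0 then (genB 2 * genB 1)⁻¹ * FreeGroup.of x * (genB 2 * genB 1)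
      else if x = (1, false) then (genB 2 * genB 1)⁻¹ * genA 1 * genB 1
      else if x = (2, false) then (genB 2)⁻¹ * (genB 1)⁻¹ * genA 2 * genB 2
      else FreeGroup.of x)
    (fun x => if x.1 = 0 then genB 2 * genB 1 * FreeGroup.of x * (genB 2 * genB 1)⁻¹
      else if x = (1, false) then genB 2 * genB 1 * genA 1 * (genB 1)⁻¹
      else if x = (2, false) then genB 1 * genB 2 * genA 2 * (genB 2)⁻¹
      else FreeGroup.of x)
    ((genB 1)⁻¹ * (genB 2)⁻¹) (genB 2 * genB 1) (by decide) (by decide) (by decide) (by decide)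
  -- values on the generators
  have ha0 : χ (SurfaceGroup.a 0) = (SurfaceGroup.b 2 * SurfaceGroup.b 1)⁻¹ * SurfaceGroup.a 0 *
      (SurfaceGroup.b 2 * SurfaceGroup.b 1) := by
    simp [SurfaceGroup.a, SurfaceGroup.b, PresentedGroup.of, hχ, FreeGroup.lift_apply_of, genA, genB]
  have hb0 : χ (SurfaceGroup.b 0) = (SurfaceGroup.b 2 * SurfaceGroup.b 1)⁻¹ * SurfaceGroup.b 0 *
      (SurfaceGroup.b 2 * SurfaceGroup.b 1) := by
    simp [SurfaceGroup.b, PresentedGroup.of, hχ, FreeGroup.lift_apply_of, genB]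
  have ha1 : χ (SurfaceGroup.a 1) =
      (SurfaceGroup.b 2 * SurfaceGroup.b 1)⁻¹ * SurfaceGroup.a 1 * SurfaceGroup.b 1 := by
    simp [SurfaceGroup.a, SurfaceGroup.b, PresentedGroup.of, hχ, FreeGroup.lift_apply_of, genA, genB]
  have hb1 : χ (SurfaceGroup.b 1) = SurfaceGroup.b 1 := by
    simp [SurfaceGroup.b, PresentedGroup.of, hχ, FreeGroup.lift_apply_of]
  have ha2 : χ (SurfaceGroup.a 2) =
      (SurfaceGroup.b 2)⁻¹ * (SurfaceGroup.b 1)⁻¹ * SurfaceGroup.a 2 * SurfaceGroup.b 2 := by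
    simp [SurfaceGroup.a, SurfaceGroup.b, PresentedGroup.of, hχ, FreeGroup.lift_apply_of, genA, genB]
  have hb2 : χ (SurfaceGroup.b 2) = SurfaceGroup.b 2 := by
    simp [SurfaceGroup.b, PresentedGroup.of, hχ, FreeGroup.lift_apply_of]
  -- values of the inverse on the generators of `N₀`, `N₁`
  have ka0 : χ.symm (SurfaceGroup.a 0) = SurfaceGroup.b 2 * SurfaceGroup.b 1 * SurfaceGroup.a 0 *
      (SurfaceGroup.b 2 * SurfaceGroup.b 1)⁻¹ := by
    simp [SurfaceGroup.a, SurfaceGroup.b, PresentedGroup.of, hχ', FreeGroup.lift_apply_of, genA, genB]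
  have ka1 : χ.symm (SurfaceGroup.a 1) =
      SurfaceGroup.b 2 * SurfaceGroup.b 1 * SurfaceGroup.a 1 * (SurfaceGroup.b 1)⁻¹ := by
    simp [SurfaceGroup.a, SurfaceGroup.b, PresentedGroup.of, hχ', FreeGroup.lift_apply_of, genA, genB]
  have kb1 : χ.symm (SurfaceGroup.b 1) = SurfaceGroup.b 1 := by
    simp [SurfaceGroup.b, PresentedGroup.of, hχ', FreeGroup.lift_apply_of]
  have ka2 : χ.symm (SurfaceGroup.a 2) =
      SurfaceGroup.b 1 * SurfaceGroup.b 2 * SurfaceGroup.a 2 * (SurfaceGroup.b 2)⁻¹ := by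
    simp [SurfaceGroup.a, SurfaceGroup.b, PresentedGroup.of, hχ', FreeGroup.lift_apply_of, genA, genB]
  have kb2 : χ.symm (SurfaceGroup.b 2) = SurfaceGroup.b 2 := by
    simp [SurfaceGroup.b, PresentedGroup.of, hχ', FreeGroup.lift_apply_of]
  -- stability of `N₀ = ⟪a₁, a₂, b₃⟫`
  have hN0 : (s4Kernels 0).map χ.toMonoidHom = s4Kernels 0 := by
    rw [RelatorAut.s4Kernels_zero]
    refine RelatorAut.map_normalClosure_eq_of χ _ _ ?_ ?_
    · rintro x hx
      simp only [Set.mem_insert_iff, Set.mem_singleton_iff] at hx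
      rcases hx with rfl | rfl | rfl
      · rw [ha0]
        exact RelatorAut.conj_mem_nc' _ _ (subset_normalClosure (by simp))
      · rw [ha1, show (SurfaceGroup.b 2 * SurfaceGroup.b 1)⁻¹ * SurfaceGroup.a 1 * SurfaceGroup.b 1 =
            (SurfaceGroup.b 2 * SurfaceGroup.b 1)⁻¹ * SurfaceGroup.a 1 * (SurfaceGroup.b 2 * SurfaceGroup.b 1) *
              ((SurfaceGroup.b 1)⁻¹ * (SurfaceGroup.b 2)⁻¹ * SurfaceGroup.b 1) by group]
        exact mul_mem (RelatorAut.conj_mem_nc' _ _ (subset_normalClosure (by simp)))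
          (RelatorAut.conj_mem_nc' _ _ (inv_mem (subset_normalClosure (by simp))))
      · rw [hb2]
        exact subset_normalClosure (by simp)
    · rintro y hy
      simp only [Set.mem_insert_iff, Set.mem_singleton_iff] at hy
      rcases hy with rfl | rfl | rfl
      · rw [ka0]
        exact RelatorAut.conj_mem_nc _ _ (subset_normalClosure (by simp))
      · rw [ka1, show SurfaceGroup.b 2 * SurfaceGroup.b 1 * SurfaceGroup.a 1 * (SurfaceGroup.b 1)⁻¹ =
            SurfaceGroup.b 2 * SurfaceGroup.b 1 * SurfaceGroup.a 1 * (SurfaceGroup.b 2 * SurfaceGroup.b 1)⁻¹ *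
              SurfaceGroup.b 2 by group]
        exact mul_mem (RelatorAut.conj_mem_nc _ _ (subset_normalClosure (by simp)))
          (subset_normalClosure (by simp))
      · rw [kb2]
        exact subset_normalClosure (by simp)
  -- stability of `N₁ = ⟪a₁, b₂, a₃⟫`
  have hN1 : (s4Kernels 1).map χ.toMonoidHom = s4Kernels 1 := by
    rw [RelatorAut.s4Kernels_one]
    refine RelatorAut.map_normalClosure_eq_of χ _ _ ?_ ?_
    · rintro x hx
      simp only [Set.mem_insert_iff, Set.mem_singleton_iff] at hx
      rcases hx with rfl | rfl | rfl
      · rw [ha0]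
        exact RelatorAut.conj_mem_nc' _ _ (subset_normalClosure (by simp))
      · rw [hb1]
        exact subset_normalClosure (by simp)
      · rw [ha2, show (SurfaceGroup.b 2)⁻¹ * (SurfaceGroup.b 1)⁻¹ * SurfaceGroup.a 2 * SurfaceGroup.b 2 =
            (SurfaceGroup.b 1 * SurfaceGroup.b 2)⁻¹ * SurfaceGroup.a 2 * (SurfaceGroup.b 1 * SurfaceGroup.b 2) *
              ((SurfaceGroup.b 2)⁻¹ * (SurfaceGroup.b 1)⁻¹ * SurfaceGroup.b 2) by group]
        exact mul_mem (RelatorAut.conj_mem_nc' _ _ (subset_normalClosure (by simp)))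
          (RelatorAut.conj_mem_nc' _ _ (inv_mem (subset_normalClosure (by simp))))
    · rintro y hy
      simp only [Set.mem_insert_iff, Set.mem_singleton_iff] at hy
      rcases hy with rfl | rfl | rfl
      · rw [ka0]
        exact RelatorAut.conj_mem_nc _ _ (subset_normalClosure (by simp))
      · rw [kb1]
        exact subset_normalClosure (by simp)
      · rw [ka2, show SurfaceGroup.b 1 * SurfaceGroup.b 2 * SurfaceGroup.a 2 * (SurfaceGroup.b 2)⁻¹ =
            SurfaceGroup.b 1 * SurfaceGroup.b 2 * SurfaceGroup.a 2 * (SurfaceGroup.b 1 * SurfaceGroup.b 2)⁻¹ *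
              SurfaceGroup.b 1 by group]
        exact mul_mem (RelatorAut.conj_mem_nc _ _ (subset_normalClosure (by simp)))
          (subset_normalClosure (by simp))
  exact ⟨χ, ha0, hb0, ha1, hb1, ha2, hb2, hN0, hN1⟩

end Summit.SmoothPoincare4.SmoothPoincare4.Theorems.ShadowsStandard.PowerTwistAbsorption
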